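import Summits.ResolutionOfSingularities.ResolutionOfSingularities.Theorems.FrobeniusLadderFInjectiveMacaulayficationClauseOfPderivNotMem
import Summits.ResolutionOfSingularities.ResolutionOfSingularities.Theorems.FrobeniusLadderFInjectiveMacaulayficationE8OffCentreRegular
import Mathlib.RingTheory.Derivation.Basic
import HarnessLib

/-!
# The specimen `f_cusp = z² + (x²+y³)³ + w⁵` is GOOD OFF ITS CUSP CURVE `C = V(z, w, x²+y³)`, at every prime `p ∉ {2, 5}`
# (crux `FrobeniusLadder.FInjectiveMacaulayfication` stmt-ResolutionOfSingularities-15315, chain w45a, hole #3β f_cusp road (plan-1 R12.2 (iv));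
# seat res-L1-w45a-stub-2)

[OURS · L1 W4.5a] AI-written; AI review is weaker than expert review. NOT a statement of any manuscript; no named fact.

In the variable order of the landed `PConePrimeCarrier` (p505774: `G = X0² + X3⁵ + (X1² + X2³)³` is prime for every field, all `x̄ᵥ ≠ 0`),
`(z, x, y, w) = (X 0, X 1, X 2, X 3)`. The cusp curve `C = V(z, w, x²+y³) = V(x̄₀, x̄₃) ∩ X` (on `X = V(G)`, `z = w = 0` forces
`(x²+y³)³ = 0`). THEOREM `fcusp_offCurve_clause`: at every maximal ideal `Q` of `k[X]/(G)` with `x̄₀ ∉ Q ∨ x̄₃ ∉ Q` the per-stalk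
crux clause holds, for `char k = p ∉ {2, 5}` — the Jacobian criterion through `ClauseOfPderivNotMem.stub_clauseOfPderivNotMem`:
`∂₀G = 2·X0`, `∂₃G = 5·X3⁴`. This is the `hoff` input («X is good off D ∪ C», indeed off `C`) of every f_cusp road (the M2-steps of
R12.2 (iii), the fan-instance road, #3β at `η_C`). At `p = 5` the `w`-derivative vanishes identically and at `p = 2` the `z`-derivative
does; those primes are not claimed. No definitions, no named facts. [folklore]
-/

set_option linter.dupNamespace false

noncomputable section

open MvPolynomial

namespace Summit.ResolutionOfSingularities.ResolutionOfSingularities.Theorems.FInjectiveMacaulayfication.FcuspOffCurve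

open Summit.ResolutionOfSingularities.ResolutionOfSingularities.Theorems.FInjectiveMacaulayfication

variable {k : Type} [Field k]

/-- `∂₀ G = 2·X0` and `∂₃ G = 5·X3⁴`. [folklore] -/
theorem pderivs_G (A : Type) [CommRing A] :
    MvPolynomial.pderiv 0 (X 0 ^ 2 + X 3 ^ 5 + (X 1 ^ 2 + X 2 ^ 3) ^ 3 : MvPolynomial (Fin 4) A) = C 2 * X 0 ∧
      MvPolynomial.pderiv 3 (X 0 ^ 2 + X 3 ^ 5 + (X 1 ^ 2 + X 2 ^ 3) ^ 3 : MvPolynomial (Fin 4) A) = C 5 * X 3 ^ 4 := by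
  constructor
  · simp only [map_add, MvPolynomial.pderiv_pow, MvPolynomial.pderiv_X_self,
      MvPolynomial.pderiv_X_of_ne (show (1 : Fin 4) ≠ 0 by decide), MvPolynomial.pderiv_X_of_ne (show (2 : Fin 4) ≠ 0 by decide),
      MvPolynomial.pderiv_X_of_ne (show (3 : Fin 4) ≠ 0 by decide), mul_zero, add_zero, mul_one, map_ofNat]
    ring
  · simp only [map_add, MvPolynomial.pderiv_pow, MvPolynomial.pderiv_X_self,
      MvPolynomial.pderiv_X_of_ne (show (0 : Fin 4) ≠ 3 by decide), MvPolynomial.pderiv_X_of_ne (show (1 : Fin 4) ≠ 3 by decide),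
      MvPolynomial.pderiv_X_of_ne (show (2 : Fin 4) ≠ 3 by decide), mul_zero, add_zero, zero_add, mul_one, map_ofNat]
    ring

/-- A prime `p` different from the prime `q` is nonzero in a field of characteristic `p`… rather: `(q : k) ≠ 0` when `char k = p ≠ q`,
`q` prime. [folklore] -/
theorem natCast_prime_ne_zero_of_charP_ne (p : ℕ) [Fact p.Prime] [CharP k p] (q : ℕ) (hq : q.Prime) (hpq : p ≠ q) :
    (q : k) ≠ 0 := fun h =>
  hpq ((Nat.prime_dvd_prime_iff_eq (Fact.out : p.Prime) hq).mp ((CharP.cast_eq_zero_iff k p q).mp h))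

/-- **`f_cusp` IS GOOD OFF ITS CUSP CURVE** (`char k = p ∉ {2,5}`): at every maximal ideal `Q` of `k[z,x,y,w]/(z² + w⁵ + (x²+y³)³)` with
`z̄ ∉ Q` or `w̄ ∉ Q` the localisation is Cohen–Macaulay with all parameter ideals Frobenius closed (it is regular: `∂_z = 2z` resp.
`∂_w = 5w⁴` survives in the residue field). [folklore] -/
theorem fcusp_offCurve_clause (p : ℕ) [Fact p.Prime] (hp2 : p ≠ 2) (hp5 : p ≠ 5) (k : Type) [Field k] [CharP k p]
    (G : MvPolynomial (Fin 4) k) (hG : G = X 0 ^ 2 + X 3 ^ 5 + (X 1 ^ 2 + X 2 ^ 3) ^ 3) :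
    ∀ (Q : Ideal (MvPolynomial (Fin 4) k ⧸ Ideal.span {G})) [Q.IsMaximal],
      (Ideal.Quotient.mk (Ideal.span {G}) (MvPolynomial.X 0) ∉ Q ∨ Ideal.Quotient.mk (Ideal.span {G}) (MvPolynomial.X 3) ∉ Q) →
      ∀ d : ℕ, ringKrullDim (Localization.AtPrime Q) = d → ∀ s : Fin d → Localization.AtPrime Q,
        (Ideal.span (Set.range s)).radical.IsMaximal →
          RingTheory.Sequence.IsWeaklyRegular (Localization.AtPrime Q) (List.ofFn s) ∧
          ∀ y : Localization.AtPrime Q, (∃ e : ℕ, y ^ p ^ e ∈ Ideal.span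
            ((fun z : Localization.AtPrime Q => z ^ p ^ e) ''
              (Ideal.span (Set.range s) : Set (Localization.AtPrime Q)))) → y ∈ Ideal.span (Set.range s) := by
  intro Q _ hQ
  haveI hprime : (Q.comap (Ideal.Quotient.mk (Ideal.span {G}))).IsPrime := Ideal.comap_isPrime _ _
  have hmem : ∀ q : MvPolynomial (Fin 4) k, q ∈ Q.comap (Ideal.Quotient.mk (Ideal.span {G})) ↔
      Ideal.Quotient.mk (Ideal.span {G}) q ∈ Q := fun q => Ideal.mem_comap
  obtain ⟨hd0, hd3⟩ := pderivs_G k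
  rw [← hG] at hd0 hd3
  have h2 : (2 : k) ≠ 0 := by exact_mod_cast natCast_prime_ne_zero_of_charP_ne (k := k) p 2 Nat.prime_two hp2
  have h5 : (5 : k) ≠ 0 := by exact_mod_cast natCast_prime_ne_zero_of_charP_ne (k := k) p 5 (by norm_num) hp5
  rcases hQ with hX0 | hX3
  · -- `∂₀ G = 2·X0 ∉ P`
    refine ClauseOfPderivNotMem.stub_clauseOfPderivNotMem p k 4 G Q 0 ?_
    rw [hd0]
    intro h
    exact hX0 ((hmem _).mp (E8OffCentreRegular.mem_of_C_mul_mem _ h2 h))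
  · -- `∂₃ G = 5·X3⁴ ∉ P`
    refine ClauseOfPderivNotMem.stub_clauseOfPderivNotMem p k 4 G Q 3 ?_
    rw [hd3]
    intro h
    exact hX3 ((hmem _).mp (hprime.mem_of_pow_mem 4 (E8OffCentreRegular.mem_of_C_mul_mem _ h5 h)))

/-- The off-curve locus in the form «some generator of `I_C = (x̄₀, x̄₃)` misses `Q`» used by open-restricted engines: for every
maximal `Q` NOT containing the image of `(X0, X3)` the clause holds (`p ∉ {2,5}`). [folklore] -/
theorem fcusp_clause_of_not_le (p : ℕ) [Fact p.Prime] (hp2 : p ≠ 2) (hp5 : p ≠ 5) (k : Type) [Field k] [CharP k p]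
    (G : MvPolynomial (Fin 4) k) (hG : G = X 0 ^ 2 + X 3 ^ 5 + (X 1 ^ 2 + X 2 ^ 3) ^ 3) :
    ∀ (Q : Ideal (MvPolynomial (Fin 4) k ⧸ Ideal.span {G})) [Q.IsMaximal],
      ¬ (Ideal.span {Ideal.Quotient.mk (Ideal.span {G}) (MvPolynomial.X 0), Ideal.Quotient.mk (Ideal.span {G}) (MvPolynomial.X 3)} ≤ Q) →
      ∀ d : ℕ, ringKrullDim (Localization.AtPrime Q) = d → ∀ s : Fin d → Localization.AtPrime Q,
        (Ideal.span (Set.range s)).radical.IsMaximal →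
          RingTheory.Sequence.IsWeaklyRegular (Localization.AtPrime Q) (List.ofFn s) ∧
          ∀ y : Localization.AtPrime Q, (∃ e : ℕ, y ^ p ^ e ∈ Ideal.span
            ((fun z : Localization.AtPrime Q => z ^ p ^ e) ''
              (Ideal.span (Set.range s) : Set (Localization.AtPrime Q)))) → y ∈ Ideal.span (Set.range s) := by
  intro Q _ hQ
  refine fcusp_offCurve_clause p hp2 hp5 k G hG Q ?_
  by_contra h
  rw [not_or, not_not, not_not] at h
  apply hQ
  rw [Ideal.span_le]
  rintro x hx
  simp only [Set.mem_insert_iff, Set.mem_singleton_iff] at hx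
  rcases hx with rfl | rfl
  exacts [h.1, h.2]

end Summit.ResolutionOfSingularities.ResolutionOfSingularities.Theorems.FInjectiveMacaulayfication.FcuspOffCurve

end
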